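import Summits.NavierStokesRegularity.NavierStokesRegularity.Theses.AxisymmetricExtremality

/-!
# Route AxisymmetricExtremality — crux `MinimalDatumPFold` (stmt-NavierStokesRegularity-15452), stub `stub_liftShiftRigidity`

Registered stub of the line `registered` (`Cruxes/MinimalDatumPFold/Lines/birth.lean`, lead c1 reshape).
Target tree file: `Summits/NavierStokesRegularity/NavierStokesRegularity/Theorems/AxisymmetricExtremalityMinimalDatumPFoldShiftRigidity.lean`.

SHIFT RIGIDITY. Let `R = R_{2π/p}` be the rotation of `ℝ³` about the `x₂`-axis and let
`u₀ ∈ L³(ℝ³; ℝ³)`, not a.e. zero, satisfy `u₀ (R x − x₀) = R (u₀ x)` for a.e. `x`. Then the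
axial component `x₀ 2` of the shift vanishes.

Proof. `B x := R x − x₀` is a measure-preserving measurable bijection of `ℝ³` (a linear isometry
followed by a translation) lowering the height `x 2` by `c := x₀ 2`, and the density
`g := ‖u₀‖ₑ ^ 3` is `B`-invariant a.e. (`‖R v‖ = ‖v‖`) with `∫⁻ g < ∞`. Changing variables along
`B`, the lower-half-space integrals `F t := ∫⁻_{x 2 < t} g` satisfy `F t = F (t + c)`. If
`c ≠ 0`, every slab integral `∫⁻_{t ≤ x 2 < t + |c|} g = F (t + |c|) − F t` vanishes (everything
is finite), and the slabs `[n|c|, (n + 1)|c|)`, `n ∈ ℤ`, cover `ℝ³`; so `∫⁻ g = 0`, i.e. `u₀ = 0`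
a.e. — a contradiction. The argument is uniform in the angle `2π/p` (no `p ≥ 2` needed) and is
packaged in three measure-theoretic lemmas on an abstract measure space (`shiftRigidity_*`).
-/

set_option linter.dupNamespace false

noncomputable section

open MeasureTheory Set Function Filter Topology
open scoped ENNReal NNReal

namespace Summit.NavierStokesRegularity.NavierStokesRegularity.Theorems

/-- **Slabs of a shift-periodic finite mass are null.** If the lower-half-space integrals
`t ↦ ∫⁻_{η < t} g` of a density `g` of finite total integral are invariant under `t ↦ t + a`
for some `a > 0`, then `∫⁻ g = 0`: each slab integral `∫⁻_{t ≤ η < t + a} g` vanishes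
(`F (t + a) = F t + slab`, all finite) and the slabs `[na, (n+1)a)`, `n ∈ ℤ`, cover the space.
[folklore] -/
theorem shiftRigidity_lintegral_eq_zero_of_shift {α : Type*} [MeasurableSpace α] {μ : Measure α}
    {η : α → ℝ} (hη : Measurable η) {a : ℝ} (ha : 0 < a) {g : α → ℝ≥0∞}
    (hF : ∀ t : ℝ, ∫⁻ x in η ⁻¹' Iio (t + a), g x ∂μ = ∫⁻ x in η ⁻¹' Iio t, g x ∂μ)
    (hfin : ∫⁻ x, g x ∂μ ≠ ⊤) : ∫⁻ x, g x ∂μ = 0 := by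
  -- every slab integral vanishes
  have hG : ∀ t : ℝ, ∫⁻ x in η ⁻¹' Ico t (t + a), g x ∂μ = 0 := by
    intro t
    have hFt : ∫⁻ x in η ⁻¹' Iio t, g x ∂μ ≠ ⊤ :=
      ((setLIntegral_le_lintegral _ _).trans_lt hfin.lt_top).ne
    have hunion : η ⁻¹' Iio (t + a) = η ⁻¹' Iio t ∪ η ⁻¹' Ico t (t + a) := by
      rw [← preimage_union, Iio_union_Ico_eq_Iio (le_add_of_nonneg_right ha.le)]
    have hdisj : Disjoint (η ⁻¹' Iio t) (η ⁻¹' Ico t (t + a)) :=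
      disjoint_left.2 fun x (hx : η x < t) (hx' : t ≤ η x ∧ η x < t + a) => hx.not_ge hx'.1
    have h := hF t
    rw [hunion, lintegral_union (hη measurableSet_Ico) hdisj] at h
    exact (ENNReal.add_right_inj hFt).1 (h.trans (add_zero _).symm)
  -- the slabs `[n a, n a + a)`, `n ∈ ℤ`, cover the space
  have hcover : (univ : Set α) ⊆ ⋃ n : ℤ, η ⁻¹' Ico ((n : ℝ) * a) ((n : ℝ) * a + a) := by
    intro x _
    simp only [mem_iUnion, mem_preimage, mem_Ico]
    refine ⟨⌊η x / a⌋, ?_, ?_⟩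
    · have h := Int.floor_le (η x / a)
      rwa [le_div_iff₀ ha] at h
    · have h := Int.lt_floor_add_one (η x / a)
      rw [div_lt_iff₀ ha, add_mul, one_mul] at h
      exact h
  refine le_antisymm ?_ zero_le
  calc ∫⁻ x, g x ∂μ = ∫⁻ x in univ, g x ∂μ := (setLIntegral_univ _).symm
    _ ≤ ∫⁻ x in ⋃ n : ℤ, η ⁻¹' Ico ((n : ℝ) * a) ((n : ℝ) * a + a), g x ∂μ :=
        lintegral_mono_set hcover
    _ ≤ ∑' n : ℤ, ∫⁻ x in η ⁻¹' Ico ((n : ℝ) * a) ((n : ℝ) * a + a), g x ∂μ :=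
        lintegral_iUnion_le _ _
    _ = 0 := by simp only [hG, tsum_zero]

/-- **Change of variables along a height-lowering symmetry.** If `B` is a measure-preserving
measurable embedding with `η (B x) = η x − c` and the density `g` is `B`-invariant a.e., then
`∫⁻_{η < t} g = ∫⁻_{η < t + c} g` (`B ⁻¹' {η < t} = {η < t + c}`). [folklore] -/
theorem shiftRigidity_setLIntegral_halfSpace {α : Type*} [MeasurableSpace α] {μ : Measure α}
    {B : α → α} (hB : MeasurePreserving B μ μ) (hBe : MeasurableEmbedding B) {η : α → ℝ} {c : ℝ}
    (hBη : ∀ x, η (B x) = η x - c) {g : α → ℝ≥0∞} (hg : ∀ᵐ x ∂μ, g (B x) = g x) (t : ℝ) :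
    ∫⁻ x in η ⁻¹' Iio t, g x ∂μ = ∫⁻ x in η ⁻¹' Iio (t + c), g x ∂μ := by
  have hpre : B ⁻¹' (η ⁻¹' Iio t) = η ⁻¹' Iio (t + c) := by
    ext x
    simp only [mem_preimage, mem_Iio, hBη, sub_lt_iff_lt_add]
  calc ∫⁻ x in η ⁻¹' Iio t, g x ∂μ = ∫⁻ x in B ⁻¹' (η ⁻¹' Iio t), g (B x) ∂μ :=
        (hB.setLIntegral_comp_preimage_emb hBe g _).symm
    _ = ∫⁻ x in η ⁻¹' Iio (t + c), g (B x) ∂μ := by rw [hpre]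
    _ = ∫⁻ x in η ⁻¹' Iio (t + c), g x ∂μ := lintegral_congr_ae (ae_restrict_of_ae hg)

/-- **An invariant finite mass under a height-shifting symmetry is zero.** If `B` is a
measure-preserving measurable embedding shifting a measurable height `η` by a constant `c ≠ 0`
(`η (B x) = η x − c`) and `g` is a `B`-invariant (a.e.) density of finite integral, then
`∫⁻ g = 0`. [folklore] -/
theorem shiftRigidity_lintegral_eq_zero {α : Type*} [MeasurableSpace α] {μ : Measure α}
    {B : α → α} (hB : MeasurePreserving B μ μ) (hBe : MeasurableEmbedding B) {η : α → ℝ}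
    (hη : Measurable η) {c : ℝ} (hc : c ≠ 0) (hBη : ∀ x, η (B x) = η x - c) {g : α → ℝ≥0∞}
    (hg : ∀ᵐ x ∂μ, g (B x) = g x) (hfin : ∫⁻ x, g x ∂μ ≠ ⊤) : ∫⁻ x, g x ∂μ = 0 := by
  have hF := shiftRigidity_setLIntegral_halfSpace hB hBe hBη hg
  refine shiftRigidity_lintegral_eq_zero_of_shift hη (abs_pos.2 hc) (fun t => ?_) hfin
  rcases lt_or_gt_of_ne hc with hneg | hpos
  · rw [abs_of_neg hneg, hF (t + -c), neg_add_cancel_right]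
  · rw [abs_of_pos hpos, ← hF t]

/-- The rotation by the angle `θ` about the `x₂`-axis preserves the Euclidean norm of `ℝ³`
(`cos² + sin² = 1`). [folklore] -/
theorem shiftRigidity_norm_rot (θ : ℝ) (x : EuclideanSpace ℝ (Fin 3)) :
    ‖(WithLp.toLp 2 ![Real.cos θ * x 0 - Real.sin θ * x 1, Real.sin θ * x 0 + Real.cos θ * x 1,
      x 2] : EuclideanSpace ℝ (Fin 3))‖ = ‖x‖ := by
  rw [EuclideanSpace.norm_eq, EuclideanSpace.norm_eq]
  congr 1
  simp only [Fin.isValue, Real.norm_eq_abs, sq_abs, Fin.sum_univ_three, Matrix.cons_val_zero,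
    Matrix.cons_val_one, Matrix.cons_val, add_left_inj]
  linear_combination (x 0 ^ 2 + x 1 ^ 2) * Real.sin_sq_add_cos_sq θ

/-- The rotation by the angle `θ` about the `x₂`-axis is (the underlying map of) a linear
isometry equivalence of `ℝ³`. [folklore] -/
theorem shiftRigidity_exists_rotLIE (θ : ℝ) :
    ∃ L : EuclideanSpace ℝ (Fin 3) ≃ₗᵢ[ℝ] EuclideanSpace ℝ (Fin 3), ∀ x,
      L x = WithLp.toLp 2 ![Real.cos θ * x 0 - Real.sin θ * x 1,
        Real.sin θ * x 0 + Real.cos θ * x 1, x 2] := by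
  let Li : EuclideanSpace ℝ (Fin 3) →ₗᵢ[ℝ] EuclideanSpace ℝ (Fin 3) :=
    { toFun := fun x => WithLp.toLp 2 ![Real.cos θ * x 0 - Real.sin θ * x 1,
        Real.sin θ * x 0 + Real.cos θ * x 1, x 2]
      map_add' := fun x y => by ext i; fin_cases i <;> simp <;> ring
      map_smul' := fun c x => by ext i; fin_cases i <;> simp <;> ring
      norm_map' := shiftRigidity_norm_rot θ }
  exact ⟨Li.toLinearIsometryEquiv rfl, fun x => rfl⟩

/-- **Shift rigidity for a `p`-fold symmetric `L³` field.** If `u₀ ∈ L³(ℝ³; ℝ³)` is not a.e.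
zero and `u₀ (R x − x₀) = R (u₀ x)` for a.e. `x`, where `R` is the rotation by `2π/p` about the
`x₂`-axis, then the axial component of the shift vanishes: `x₀ 2 = 0`. Indeed `B x := R x − x₀`
is a measure-preserving bijection lowering the height `x 2` by `x₀ 2` and leaving the finite
density `‖u₀‖ₑ³` invariant a.e.; if `x₀ 2 ≠ 0` the half-space integrals of that density are
periodic under a nonzero shift of the level, forcing `∫⁻ ‖u₀‖ₑ³ = 0`
(`shiftRigidity_lintegral_eq_zero`), i.e. `u₀ = 0` a.e. [folklore] -/
theorem stub_liftShiftRigidity :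
    ∀ (p : ℕ) (u₀ : EuclideanSpace ℝ (Fin 3) → EuclideanSpace ℝ (Fin 3)), MeasureTheory.MemLp u₀ 3 (MeasureTheory.volume : MeasureTheory.Measure (EuclideanSpace ℝ (Fin 3))) → ¬ (u₀ =ᵐ[(MeasureTheory.volume : MeasureTheory.Measure (EuclideanSpace ℝ (Fin 3)))] (0 : EuclideanSpace ℝ (Fin 3) → EuclideanSpace ℝ (Fin 3))) → ∀ x₀ : EuclideanSpace ℝ (Fin 3), (∀ᵐ x ∂(MeasureTheory.volume : MeasureTheory.Measure (EuclideanSpace ℝ (Fin 3))), u₀ (WithLp.toLp 2 ![Real.cos (2 * Real.pi / p) * x 0 - Real.sin (2 * Real.pi / p) * x 1, Real.sin (2 * Real.pi / p) * x 0 + Real.cos (2 * Real.pi / p) * x 1, x 2] - x₀) = WithLp.toLp 2 ![Real.cos (2 * Real.pi / p) * u₀ x 0 - Real.sin (2 * Real.pi / p) * u₀ x 1, Real.sin (2 * Real.pi / p) * u₀ x 0 + Real.cos (2 * Real.pi / p) * u₀ x 1, u₀ x 2]) → x₀ 2 = 0 := by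
  intro p u₀ hL3 hne x₀ hae
  by_contra h
  obtain ⟨L, hL⟩ := shiftRigidity_exists_rotLIE (2 * Real.pi / p)
  -- the equivariance hypothesis in terms of `L`
  have hae' : ∀ᵐ x ∂(volume : Measure (EuclideanSpace ℝ (Fin 3))), u₀ (L x - x₀) = L (u₀ x) := by
    filter_upwards [hae] with x hx
    rw [hL, hL]
    exact hx
  -- `B x := L x - x₀` is a measure-preserving measurable bijection lowering `x 2` by `x₀ 2`
  have hB : MeasurePreserving (fun x => L x - x₀) volume volume :=
    (measurePreserving_sub_right volume x₀).comp L.measurePreserving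
  have hBe : MeasurableEmbedding (fun x => L x - x₀) :=
    (measurableEmbedding_subRight x₀).comp L.toHomeomorph.measurableEmbedding
  have hη : Measurable (fun x : EuclideanSpace ℝ (Fin 3) => x 2) := by fun_prop
  have hBη : ∀ x, (L x - x₀) 2 = x 2 - x₀ 2 := by
    intro x
    rw [PiLp.sub_apply, hL]
    rfl
  -- the invariant finite density `‖u₀‖ₑ ^ 3`
  have hg : ∀ᵐ x ∂(volume : Measure (EuclideanSpace ℝ (Fin 3))),
      ‖u₀ (L x - x₀)‖ₑ ^ (3 : ℝ≥0∞).toReal = ‖u₀ x‖ₑ ^ (3 : ℝ≥0∞).toReal := by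
    filter_upwards [hae'] with x hx
    rw [hx, LinearIsometryEquiv.enorm_map]
  have hfin : ∫⁻ x, ‖u₀ x‖ₑ ^ (3 : ℝ≥0∞).toReal ∂volume ≠ ⊤ :=
    (lintegral_rpow_enorm_lt_top_of_eLpNorm_lt_top three_ne_zero ENNReal.ofNat_ne_top
      hL3.eLpNorm_lt_top).ne
  have hzero := shiftRigidity_lintegral_eq_zero (g := fun x => ‖u₀ x‖ₑ ^ (3 : ℝ≥0∞).toReal)
    hB hBe hη h hBη hg hfin
  apply hne
  have h3 : eLpNorm u₀ 3 volume = 0 := by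
    rw [eLpNorm_eq_lintegral_rpow_enorm_toReal three_ne_zero ENNReal.ofNat_ne_top, hzero,
      ENNReal.zero_rpow_of_pos (one_div_pos.2 (ENNReal.toReal_pos three_ne_zero
        ENNReal.ofNat_ne_top))]
  exact (eLpNorm_eq_zero_iff hL3.1 three_ne_zero).1 h3

end Summit.NavierStokesRegularity.NavierStokesRegularity.Theorems

end
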